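import Summits.AtomisticToContinuum.Crystallization.Theorems.PalmUnimodularRigidityMinimiserShellsEnergyFloorC
import Literature.Probability.Process.PointStationaryLaw

/-!
# `StackingHinge` (stmt-AtomisticToContinuum-14993), line `Sketch`: stub `stub_rootEnergyIntegrable`

INTEGRABILITY PLUMBING. Let `P` be a probability law on configurations `μ : Measure ℝ³` that is
a.s. carried by rooted `δ`-hard-core configurations (`μ = count|S` with `0 ∈ S` and `S`
`δ`-separated, i.e. `Literature.Probability.Process.IsRootedHardCore δ μ`), `δ > 0`. Then the root
energy `h(μ) = ½ ∫ V_LJ(‖y‖) dμ` is `P`-integrable, and a.s.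
`-(250/12) δ⁻⁶ ≤ h(μ) ≤ (250/24) δ⁻¹²`; so `E_P[h]` is an honest expectation with two-sided a priori
bounds.

Proof. On the a.s. hard-core class, `h` agrees with the Giry-measurable root energy `rootEnergy'`
of the `MinimiserShells` energy-floor line (`rootEnergy'_eq_of_hc`) and obeys its bounds
(`rootEnergy'_bounds_of_hc`); hence `h` is a.e.-strongly measurable (`measurable_rootEnergy'`) and
a.e. bounded on a finite measure space, so integrable (`Integrable.of_bound`). [folklore]
-/

noncomputable section

namespace Summit.AtomisticToContinuum.Crystallization.Theorems.PricedHcpWindowsRootEnergyIntegrable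

open MeasureTheory
open Literature.Probability.Process (IsRootedHardCore)
open Literature.MathematicalPhysics.StatisticalMechanics (lennardJones)
open Summit.AtomisticToContinuum.Crystallization.Theorems.PalmUnimodularRigidityMinimiserShells.EnergyFloor
  (rootEnergy' measurable_rootEnergy' rootEnergy'_eq_of_hc rootEnergy'_bounds_of_hc)

/-- **Stub `stub_rootEnergyIntegrable`.** For a probability law `P` on configurations of `ℝ³`
a.s. carried by rooted `δ`-hard-core configurations (`δ > 0`), the root energy
`μ ↦ ½ ∫ V_LJ(‖y‖) dμ` is `P`-integrable and a.s. lies in `[-(250/12) δ⁻⁶, (250/24) δ⁻¹²]`.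
[folklore] -/
theorem stub_rootEnergyIntegrable : ∀ δ : ℝ, 0 < δ → ∀ P : MeasureTheory.Measure (MeasureTheory.Measure (EuclideanSpace ℝ (Fin 3))), MeasureTheory.IsProbabilityMeasure P → (∀ᵐ μ ∂P, (∃ S : Set (EuclideanSpace ℝ (Fin 3)), (0 : EuclideanSpace ℝ (Fin 3)) ∈ S ∧ (∀ x ∈ S, ∀ y ∈ S, x ≠ y → δ ≤ dist x y) ∧ μ = (MeasureTheory.Measure.count : MeasureTheory.Measure (EuclideanSpace ℝ (Fin 3))).restrict S)) → MeasureTheory.Integrable (fun μ : MeasureTheory.Measure (EuclideanSpace ℝ (Fin 3)) => (∫ y, Literature.MathematicalPhysics.StatisticalMechanics.lennardJones ‖y‖ ∂μ) / 2) P ∧ (∀ᵐ μ ∂P, -(250 / 12 * δ⁻¹ ^ 6) ≤ (∫ y, Literature.MathematicalPhysics.StatisticalMechanics.lennardJones ‖y‖ ∂μ) / 2 ∧ (∫ y, Literature.MathematicalPhysics.StatisticalMechanics.lennardJones ‖y‖ ∂μ) / 2 ≤ 250 / 24 * δ⁻¹ ^ 12) := by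
  intro δ hδ P hP hhc
  -- the hard-core hypothesis, read as `IsRootedHardCore δ μ` (definitionally its body)
  have hcore : ∀ᵐ μ ∂P, IsRootedHardCore δ μ := hhc
  -- on the a.s. class: the root energy IS `rootEnergy'` and obeys its two-sided bounds
  have hae : ∀ᵐ μ ∂P, (∫ y, lennardJones ‖y‖ ∂μ) / 2 = rootEnergy' μ ∧
      (-(250 / 12 * δ⁻¹ ^ 6) ≤ (∫ y, lennardJones ‖y‖ ∂μ) / 2 ∧
        (∫ y, lennardJones ‖y‖ ∂μ) / 2 ≤ 250 / 24 * δ⁻¹ ^ 12) := by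
    filter_upwards [hcore] with μ hμ
    have heq := rootEnergy'_eq_of_hc hδ hμ
    have hb := rootEnergy'_bounds_of_hc hδ hμ
    rw [← heq]
    exact ⟨rfl, hb⟩
  refine ⟨?_, hae.mono fun μ hμ => hμ.2⟩
  -- a.e.-strong measurability through the Giry-measurable representative `rootEnergy'`
  have hmeas : AEStronglyMeasurable
      (fun μ : Measure (EuclideanSpace ℝ (Fin 3)) => (∫ y, lennardJones ‖y‖ ∂μ) / 2) P := by
    refine ⟨rootEnergy', measurable_rootEnergy'.stronglyMeasurable, ?_⟩
    filter_upwards [hae] with μ hμ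
    exact hμ.1
  -- a.e. bounded on a probability space, hence integrable
  refine Integrable.of_bound hmeas (250 / 12 * δ⁻¹ ^ 6 + 250 / 24 * δ⁻¹ ^ 12) ?_
  filter_upwards [hae] with μ hμ
  have h6 : (0 : ℝ) ≤ 250 / 12 * δ⁻¹ ^ 6 := by positivity
  have h12 : (0 : ℝ) ≤ 250 / 24 * δ⁻¹ ^ 12 := by positivity
  rw [Real.norm_eq_abs, abs_le]
  constructor <;> linarith [hμ.2.1, hμ.2.2]

end Summit.AtomisticToContinuum.Crystallization.Theorems.PricedHcpWindowsRootEnergyIntegrable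

end
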